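import Summits.CriticalPhenomena.PercolationContinuityZ3.Theorems.Transplant.FKConnectivityAllQPat3Gluing
import Summits.CriticalPhenomena.PercolationContinuityZ3.Theorems.Transplant.FKConnectivityAllQPat3Functionals
import Summits.CriticalPhenomena.PercolationContinuityZ3.Theorems.Transplant.FKConnectivityAllQAntipodalPolar
import HarnessLib

/-!
# Connectivity correlation inequalities for `φ_{w,q}`, every `q > 0` — THEOREM 𝒯₁ (`T_sym`): on every two-terminal
# series–parallel network with an INNER third mark, `T_sym ≥ 0` at every level; hence Conjecture T (`δ ≥ 0`) with the apex at a
# TERMINAL and the pair = {other terminal, inner vertex}, for every `q > 0`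

Theorems file (`--supports stmt-CriticalPhenomena-4575`), census lane `prim-bschramm-census` (gen 36) of the post-continuity programme (LANE 2 bschramm, FK sub-lane);
builds on p205010 (kernel theorem, internal audit signed; external expert review pending).
No definitions, no named facts, no sorries; standard axioms.  KERNEL STATUS BEFORE THIS FILE: Conjecture T / `δ(z; s, t) ≥ 0` on
two-terminal series–parallel networks only for the pair `{s, t}` = THE TWO TERMINALS (`FK.antipodalT_nonneg_of_isTTSP`, via
Theorem U); the lane's THEOREM SP (census g34; every SP graph, every placement; audited by census g35) is a house result.  THIS
FILE makes the first member of THEOREM 𝒯₁ a kernel theorem: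
* `FK.tsym_nonneg_of_isTTSP` / `FK.tsym_nonneg` — for `FK.IsTTSP E x y`, `s` an inner vertex (on an edge of `E`, `s ≠ x, y`) and
  every nonnegative weight sequence `w`: `0 ≤ tval w E x y s T_sym`; `FK.tsym_level_nonneg` — the levelwise count form
  `2n{⊤;⊥}(ν) ≥ 2n{xy|s; xs|y}(ν) + 2n{xy|s; x|ys}(ν) + 2n{xs|y; x|ys}(ν)` at every level `ν`.
  PROOF: structural induction over `IsTTSP`; the parallel case and the three series cases (mark in either part / at the
  middle terminal) are the gluing steps `FK.tval_union_nonneg` / `FK.tval_union_nonneg₂` of `…Pat3Functionals.lean` fed with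
  the pattern-gluing theorems of `…Pat3Gluing.lean`, the exponent laws `FK.apExp_parallel/series`, and the `decide`d
  certificates `FK.tsym_cert_*` of `…Pat3Defs.lean` (census g35's fibre normal form: `T_sym` alone is a closed family); a
  single edge has no inner vertex.
* DICTIONARY to `…AntipodalPolar`: `FK.ind_pat_eq`, `FK.antipodalQ_eq_tApexTab` (the polar form `Q(ω,ω′)` is the apex table on
  patterns), `FK.antipodalT_eq_tval` (`antipodalT q z s t F ∅ = tval (q^·) F z s t T(apex)`).
* **`FK.antipodalT_nonneg_apex_left / _right`** — NEW ROWS: `0 ≤ antipodalT q x y s E ∅` and `0 ≤ antipodalT q y x s E ∅` for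
  every `q > 0` (apex = a terminal, pair = {other terminal, inner vertex}; the graph itself, `ρ = ∅`), since `T(apex) ≥ T_sym`
  coefficientwise.
Numerics (census g36, `brute.py`): 207 random TTSP networks with an inner mark, levelwise `T_sym`: 0 violations, 107 non-trivial.
[cite: AyyerLinussonRavichandran2025, §7 eq. (13)–(15) (p. 22)] [cite: Grimmett2006, §1.4 eq. (1.20) (p. 15); §3.8 (pp. 61–62)]
-/

noncomputable section

namespace Summit.CriticalPhenomena.PercolationContinuityZ3.Theorems

namespace FK

open SimpleGraph Literature.Probability.LatticeModels Literature.Probability.Percolation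
open scoped Classical

variable {V : Type*} [Fintype V]

/-! ### The four gluing steps for `T_sym` -/

section Steps

/-- **`T_sym` step, PARALLEL**: `A = E_A` a two-terminal `(x, y)`-part, `B = E_B` an `(x, y)`-part carrying the inner mark `s`.
[folklore] -/
theorem tsym_par_nonneg {EA EB : Finset (Sym2 V)} {VA VB : Set V} (hd : Disjoint EA EB)
    (hA : ∀ e ∈ (↑EA : Set (Sym2 V)), ∀ z ∈ e, z ∈ VA) (hB : ∀ e ∈ (↑EB : Set (Sym2 V)), ∀ z ∈ e, z ∈ VB)
    {x y s : V} (hS : VA ∩ VB ⊆ {x, y}) (hxy : x ≠ y) (hsV : s ∉ VA) (hsx : s ≠ x) (hsy : s ≠ y)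
    (ihB : ∀ w' : ℕ → ℝ, (∀ n, 0 ≤ w' n) → 0 ≤ tval w' EB x y s tsymTab)
    (w : ℕ → ℝ) (hw : ∀ n, 0 ≤ w n) : 0 ≤ tval w (EA ∪ EB) x y s tsymTab := by
  refine tval_union_nonneg hd (fun γ => conn γ x y) joinPar corrPar
    (fun γA hγA γB hγB => pat3_union_par hA hB hS hsV hsx hsy hγA hγB)
    (fun γA hγA γB hγB => ?_) (by decide) tsymTab muPar kPar (by decide) tsym_cert_par ihB w hw
  rw [apExp_parallel hd hA hB hS hxy le_rfl le_rfl hγA hγB, ite_and_eq_corrPar γA γB x y s,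
    ite_and_eq_corrPar (EA \ γA) (EB \ γB) x y s]

/-- **`T_sym` step, SERIES with the mark in the second part**: `E₁` an `(x, m)`-part, `E₂` an `(m, y)`-part carrying the inner
mark `s ≠ m`. [folklore] -/
theorem tsym_serL_nonneg {E₁ E₂ : Finset (Sym2 V)} {V₁ V₂ : Set V} (hd : Disjoint E₁ E₂)
    (h₁ : ∀ e ∈ (↑E₁ : Set (Sym2 V)), ∀ z ∈ e, z ∈ V₁) (h₂ : ∀ e ∈ (↑E₂ : Set (Sym2 V)), ∀ z ∈ e, z ∈ V₂)
    {x m y s : V} (hS : V₁ ∩ V₂ ⊆ {m}) (hxV : x ∉ V₂) (hyV : y ∉ V₁) (hsV : s ∉ V₁) (hxm : x ≠ m) (hym : y ≠ m)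
    (hxy : x ≠ y) (hsm : s ≠ m) (hxs : x ≠ s)
    (ihB : ∀ w' : ℕ → ℝ, (∀ n, 0 ≤ w' n) → 0 ≤ tval w' E₂ m y s tsymTab)
    (w : ℕ → ℝ) (hw : ∀ n, 0 ≤ w n) : 0 ≤ tval w (E₁ ∪ E₂) x y s tsymTab := by
  refine tval_union_nonneg hd (fun γ => conn γ x m) joinSerL corrZero
    (fun γA hγA γB hγB => pat3_union_serL h₁ h₂ hS hxV hyV hsV hxm hym hxy hsm hxs hγA hγB)
    (fun γA hγA γB hγB => ?_) (by decide) tsymTab muSer kSer (by decide) tsym_cert_serL ihB w hw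
  simp only [corrZero, add_zero]
  exact apExp_series hd h₁ h₂ hS le_rfl le_rfl hγA hγB

/-- **`T_sym` step, SERIES with the mark in the first part**: `E₁` an `(x, m)`-part carrying the inner mark `s ≠ m`, `E₂` an
`(m, y)`-part. [folklore] -/
theorem tsym_serR_nonneg {E₁ E₂ : Finset (Sym2 V)} {V₁ V₂ : Set V} (hd : Disjoint E₁ E₂)
    (h₁ : ∀ e ∈ (↑E₁ : Set (Sym2 V)), ∀ z ∈ e, z ∈ V₁) (h₂ : ∀ e ∈ (↑E₂ : Set (Sym2 V)), ∀ z ∈ e, z ∈ V₂)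
    {x m y s : V} (hS : V₁ ∩ V₂ ⊆ {m}) (hxV : x ∉ V₂) (hsV : s ∉ V₂) (hyV : y ∉ V₁) (hxm : x ≠ m) (hym : y ≠ m)
    (hxy : x ≠ y) (hsm : s ≠ m) (hsy : s ≠ y)
    (ihB : ∀ w' : ℕ → ℝ, (∀ n, 0 ≤ w' n) → 0 ≤ tval w' E₁ x m s tsymTab)
    (w : ℕ → ℝ) (hw : ∀ n, 0 ≤ w n) : 0 ≤ tval w (E₁ ∪ E₂) x y s tsymTab := by
  rw [Finset.union_comm]
  refine tval_union_nonneg hd.symm (fun γ => conn γ m y) joinSerR corrZero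
    (fun γA hγA γB hγB => ?_) (fun γA hγA γB hγB => ?_) (by decide) tsymTab muSer kSer (by decide) tsym_cert_serR ihB w hw
  · rw [Finset.union_comm]
    exact pat3_union_serR h₁ h₂ hS hxV hsV hyV hxm hym hxy hsm hsy hγB hγA
  · simp only [corrZero, add_zero]
    rw [Finset.union_comm E₂, Finset.union_comm γA, add_comm (apExp E₂ γA)]
    exact apExp_series hd h₁ h₂ hS le_rfl le_rfl hγB hγA

/-- **`T_sym` step, SERIES at the mark**: `E₁` an `(x, s)`-part and `E₂` an `(s, y)`-part (the inner mark is the middle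
terminal). [folklore] -/
theorem tsym_serS_nonneg {E₁ E₂ : Finset (Sym2 V)} {V₁ V₂ : Set V} (hd : Disjoint E₁ E₂)
    (h₁ : ∀ e ∈ (↑E₁ : Set (Sym2 V)), ∀ z ∈ e, z ∈ V₁) (h₂ : ∀ e ∈ (↑E₂ : Set (Sym2 V)), ∀ z ∈ e, z ∈ V₂)
    {x s y : V} (hS : V₁ ∩ V₂ ⊆ {s}) (hxV : x ∉ V₂) (hyV : y ∉ V₁) (hxs : x ≠ s) (hys : y ≠ s) (hxy : x ≠ y)
    (w : ℕ → ℝ) (hw : ∀ n, 0 ≤ w n) : 0 ≤ tval w (E₁ ∪ E₂) x y s tsymTab :=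
  tval_union_nonneg₂ hd (fun γ => conn γ x s) (fun γ => conn γ s y) joinSerS
    (fun _ hγ₁ _ hγ₂ => pat3_union_serS h₁ h₂ hS hxV hyV hxs hys hxy hγ₁ hγ₂)
    (fun _ hγ₁ _ hγ₂ => apExp_series hd h₁ h₂ hS le_rfl le_rfl hγ₁ hγ₂) tsymTab tsym_cert_serS w hw

end Steps

/-! ### THEOREM 𝒯₁ (`T_sym`) -/

section Main

/-- **THEOREM 𝒯₁ (`T_sym` part; census g33/g34 THEOREM SP §3, house result — here a kernel theorem).**  For every two-terminal
series–parallel network `E` between `x` and `y` (`FK.IsTTSP E x y`), every INNER vertex `s` of `E` (on an edge of `E`, distinct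
from the terminals) and every nonnegative weight sequence `w`,
`0 ≤ tval w E x y s T_sym = ∑_{γ ⊆ E} w(k(γ)+k(E∖γ)) · T_sym(pat_{x,y,s} γ, pat_{x,y,s} (E∖γ))`;
equivalently (weights `1{· = ν}`), at every level `ν`:
`2n{⊤;⊥}(ν) ≥ 2n{xy|s; xs|y}(ν) + 2n{xy|s; x|ys}(ν) + 2n{xs|y; x|ys}(ν)` — among complementary pairs of configurations at
total cluster count `ν`, the pairs (all three marks joined / all three separated) are at least as many as the pairs showing two
DIFFERENT two-block patterns.  PROOF: structural induction over the series/parallel decomposition; the four gluing situations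
(PAR, SER with the mark on either side, SER at the mark) are discharged by the fibre certificates `tsym_cert_*` (census g35's
fibre normal form: each fibre of `T_sym` is, after symmetrisation, termwise nonnegative or dominates `T_sym` of the marked part,
possibly one level up), via `tval_union_nonneg` / `tval_serS_nonneg`; a single edge has no inner vertex.
[cite: AyyerLinussonRavichandran2025, §7 eq. (13)–(15) (p. 22)] [cite: Grimmett2006, §3.8 (pp. 61–62)] -/
theorem tsym_nonneg_of_isTTSP {E : Finset (Sym2 V)} {x y : V} (hE : IsTTSP E x y) :
    ∀ s : V, (∃ e ∈ E, s ∈ e) → s ≠ x → s ≠ y →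
      ∀ w : ℕ → ℝ, (∀ n, 0 ≤ w n) → 0 ≤ tval w E x y s tsymTab := by
  induction hE with
  | @edge a b hab =>
    intro s hs hsa hsb w hw
    obtain ⟨e, he, hse⟩ := hs
    rw [Finset.mem_singleton] at he
    subst he
    rcases Sym2.mem_iff.1 hse with h | h
    · exact absurd h hsa
    · exact absurd h hsb
  | @series E₁ E₂ a m b h₁ h₂ hd hV ha hb ih₁ ih₂ =>
    intro s hs hsa hsb w hw
    have g₁ : ∀ e ∈ (↑E₁ : Set (Sym2 V)), ∀ z ∈ e, z ∈ {z : V | ∃ e ∈ E₁, z ∈ e} := fun e he z hz => ⟨e, he, hz⟩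
    have g₂ : ∀ e ∈ (↑E₂ : Set (Sym2 V)), ∀ z ∈ e, z ∈ {z : V | ∃ e ∈ E₂, z ∈ e} := fun e he z hz => ⟨e, he, hz⟩
    have gS : {z : V | ∃ e ∈ E₁, z ∈ e} ∩ {z : V | ∃ e ∈ E₂, z ∈ e} ⊆ ({m} : Set V) :=
      fun z hz => hV z hz.1 hz.2
    have gaV₂ : a ∉ {z : V | ∃ e ∈ E₂, z ∈ e} := fun ⟨e, he, hae⟩ => ha e he hae
    have gbV₁ : b ∉ {z : V | ∃ e ∈ E₁, z ∈ e} := fun ⟨e, he, hbe⟩ => hb e he hbe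
    have gam : a ≠ m := by
      obtain ⟨e, he, hme⟩ := h₂.left_mem
      intro ham; exact ha e he (ham ▸ hme)
    have gbm : b ≠ m := by
      obtain ⟨e, he, hme⟩ := h₁.right_mem
      intro hbm; exact hb e he (hbm ▸ hme)
    have gab : a ≠ b := by
      obtain ⟨e, he, hae⟩ := h₁.left_mem
      intro hab; exact hb e he (hab ▸ hae)
    by_cases hsm : s = m
    · subst hsm
      exact tsym_serS_nonneg hd g₁ g₂ gS gaV₂ gbV₁ gam gbm gab w hw
    · obtain ⟨e, he, hse⟩ := hs
      rcases Finset.mem_union.1 he with he₁ | he₂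
      · have hsV₂ : s ∉ {z : V | ∃ e ∈ E₂, z ∈ e} := fun hs₂ => hsm (hV s ⟨e, he₁, hse⟩ hs₂)
        exact tsym_serR_nonneg hd g₁ g₂ gS gaV₂ hsV₂ gbV₁ gam gbm gab hsm hsb (ih₁ s ⟨e, he₁, hse⟩ hsa hsm) w hw
      · have hsV₁ : s ∉ {z : V | ∃ e ∈ E₁, z ∈ e} := fun hs₁ => hsm (hV s hs₁ ⟨e, he₂, hse⟩)
        have has : a ≠ s := fun h => gaV₂ (h ▸ ⟨e, he₂, hse⟩)
        exact tsym_serL_nonneg hd g₁ g₂ gS gaV₂ gbV₁ hsV₁ gam gbm gab hsm has (ih₂ s ⟨e, he₂, hse⟩ hsm hsb) w hw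
  | @parallel E₁ E₂ a b h₁ h₂ hd hV ih₁ ih₂ =>
    intro s hs hsa hsb w hw
    have g₁ : ∀ e ∈ (↑E₁ : Set (Sym2 V)), ∀ z ∈ e, z ∈ {z : V | ∃ e ∈ E₁, z ∈ e} := fun e he z hz => ⟨e, he, hz⟩
    have g₂ : ∀ e ∈ (↑E₂ : Set (Sym2 V)), ∀ z ∈ e, z ∈ {z : V | ∃ e ∈ E₂, z ∈ e} := fun e he z hz => ⟨e, he, hz⟩
    have gS : {z : V | ∃ e ∈ E₁, z ∈ e} ∩ {z : V | ∃ e ∈ E₂, z ∈ e} ⊆ ({a, b} : Set V) := by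
      intro z hz
      rcases hV z hz.1 hz.2 with h | h
      · exact Or.inl h
      · exact Or.inr h
    have gS' : {z : V | ∃ e ∈ E₂, z ∈ e} ∩ {z : V | ∃ e ∈ E₁, z ∈ e} ⊆ ({a, b} : Set V) :=
      fun z hz => gS ⟨hz.2, hz.1⟩
    have gab : a ≠ b := h₁.ne
    obtain ⟨e, he, hse⟩ := hs
    rcases Finset.mem_union.1 he with he₁ | he₂
    · have hsV₂ : s ∉ {z : V | ∃ e ∈ E₂, z ∈ e} := by
        intro hs₂
        rcases hV s ⟨e, he₁, hse⟩ hs₂ with h | h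
        · exact hsa h
        · exact hsb h
      rw [Finset.union_comm]
      exact tsym_par_nonneg hd.symm g₂ g₁ gS' gab hsV₂ hsa hsb (ih₁ s ⟨e, he₁, hse⟩ hsa hsb) w hw
    · have hsV₁ : s ∉ {z : V | ∃ e ∈ E₁, z ∈ e} := by
        intro hs₁
        rcases hV s hs₁ ⟨e, he₂, hse⟩ with h | h
        · exact hsa h
        · exact hsb h
      exact tsym_par_nonneg hd g₁ g₂ gS gab hsV₁ hsa hsb (ih₂ s ⟨e, he₂, hse⟩ hsa hsb) w hw

/-- **THEOREM 𝒯₁ (`T_sym`), packaged**: `0 ≤ tval w E x y s T_sym` for a two-terminal series–parallel network `E` between `x`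
and `y`, an inner vertex `s`, and nonnegative weights `w`. [cite: AyyerLinussonRavichandran2025, §7 (p. 22)] -/
theorem tsym_nonneg {E : Finset (Sym2 V)} {x y s : V} (hE : IsTTSP E x y) (hs : ∃ e ∈ E, s ∈ e) (hsx : s ≠ x)
    (hsy : s ≠ y) {w : ℕ → ℝ} (hw : ∀ n, 0 ≤ w n) : 0 ≤ tval w E x y s tsymTab :=
  tsym_nonneg_of_isTTSP hE s hs hsx hsy w hw

/-- **THEOREM 𝒯₁ (`T_sym`), levelwise count form**: at every level `ν` (total cluster count of the complementary pair),
`0 ≤ ∑_{γ ⊆ E, k(γ)+k(E∖γ) = ν} T_sym(pat γ, pat (E∖γ))`, i.e. `2n{⊤;⊥}(ν) ≥ 2n{xy|s; xs|y}(ν) + 2n{xy|s; x|ys}(ν) + 2n{xs|y; x|ys}(ν)`.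
[cite: AyyerLinussonRavichandran2025, §7 (p. 22)] -/
theorem tsym_level_nonneg {E : Finset (Sym2 V)} {x y s : V} (hE : IsTTSP E x y) (hs : ∃ e ∈ E, s ∈ e) (hsx : s ≠ x)
    (hsy : s ≠ y) (ν : ℕ) :
    0 ≤ ∑ γ ∈ E.powerset with apExp E γ = ν, tsymTab (pat3 γ x y s) (pat3 (E \ γ) x y s) := by
  have h := tsym_nonneg hE hs hsx hsy (w := fun n => if n = ν then (1 : ℝ) else 0)
    (fun n => by split_ifs <;> norm_num)
  unfold tval at h
  rw [Finset.sum_filter]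
  have : (0 : ℝ) ≤ ∑ γ ∈ E.powerset, ((if apExp E γ = ν then tsymTab (pat3 γ x y s) (pat3 (E \ γ) x y s) else 0 : ℤ) : ℝ) := by
    refine h.trans_eq (Finset.sum_congr rfl fun γ _ => ?_)
    by_cases hγ : apExp E γ = ν <;> simp [hγ]
  exact_mod_cast this

end Main

/-! ### Conjecture T with the apex at a terminal -/

section ApexTerminal

open Literature.Probability.Percolation.DecisionTree (ind ind_of_mem ind_of_not_mem)

variable {E : Finset (Sym2 V)} {x y s : V}

omit [Fintype V] in
/-- The five pattern indicators of `…AntipodalPolar` read off `pat3` (marks in the order `(z, s, t)`). [folklore] -/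
theorem ind_pat_eq (z s t : V) (γ : Finset (Sym2 V)) :
    ind (patSep z s t) (↑γ : BondConfig V) = (if pat3 γ z s t = Pat3.sep then 1 else 0) ∧
    ind (patAll z s t) (↑γ : BondConfig V) = (if pat3 γ z s t = Pat3.all then 1 else 0) ∧
    ind (patST z s t) (↑γ : BondConfig V) = (if pat3 γ z s t = Pat3.ys_x then 1 else 0) ∧
    ind (patZS z s t) (↑γ : BondConfig V) = (if pat3 γ z s t = Pat3.xy_s then 1 else 0) ∧
    ind (patZT z s t) (↑γ : BondConfig V) = (if pat3 γ z s t = Pat3.xs_y then 1 else 0) := by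
  have h1 := pat3_xy_iff γ z s t
  have h2 := pat3_xs_iff γ z s t
  have h3 := pat3_ys_iff γ z s t
  cases hP : pat3 γ z s t <;> simp only [hP, Pat3.xy, Pat3.xs, Pat3.ys, true_iff, false_iff, Bool.false_eq_true] at h1 h2 h3 <;>
    simp [ind, patSep, patAll, patST, patZS, patZT, openConn, h1, h2, h3]

omit [Fintype V] in
/-- **Conjecture T's polar form is the apex table on patterns.** [cite: AyyerLinussonRavichandran2025, §7 (p. 22)] -/
theorem antipodalQ_eq_tApexTab (z s t : V) (γ γ' : Finset (Sym2 V)) :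
    antipodalQ z s t (↑γ : BondConfig V) (↑γ' : BondConfig V) = (tApexTab (pat3 γ z s t) (pat3 γ' z s t) : ℝ) := by
  obtain ⟨a1, a2, a3, a4, a5⟩ := ind_pat_eq z s t γ
  obtain ⟨b1, b2, b3, b4, b5⟩ := ind_pat_eq z s t γ'
  unfold antipodalQ
  rw [a1, a2, a3, a4, a5, b1, b2, b3, b4, b5]
  generalize pat3 γ z s t = P
  generalize pat3 γ' z s t = Q
  cases P <;> cases Q <;> simp [tApexTab]

/-- **Conjecture T's weight-free antipodal sum of a graph is the `q`-weighted evaluation of the apex table**: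
`antipodalT q z s t F ∅ = tval (q^·) F z s t T(apex)`. [cite: AyyerLinussonRavichandran2025, §7 (p. 22)] -/
theorem antipodalT_eq_tval (q : ℝ) (z s t : V) (F : Finset (Sym2 V)) :
    antipodalT q z s t (↑F : BondConfig V) ∅ = tval (fun n => q ^ n) F z s t tApexTab := by
  unfold antipodalT tval
  set G : BondConfig V → ℝ := fun X => if X ⊆ (↑F : BondConfig V) then
      q ^ (clusterCount ((∅ : BondConfig V) ∪ X) ∅ + clusterCount ((∅ : BondConfig V) ∪ ((↑F : BondConfig V) \ X)) ∅) *
        antipodalQ z s t ((∅ : BondConfig V) ∪ X) ((∅ : BondConfig V) ∪ ((↑F : BondConfig V) \ X)) else 0 with hG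
  have h1 : (∑ X : BondConfig V, G X) = ∑ S : Finset (Sym2 V), G (↑S : BondConfig V) := by
    rw [← Equiv.sum_comp Fintype.finsetEquivSet G]
    rfl
  have h2 : (∑ S : Finset (Sym2 V), G (↑S : BondConfig V)) =
      ∑ S : Finset (Sym2 V), if S ∈ F.powerset then G (↑S : BondConfig V) else 0 := by
    refine Finset.sum_congr rfl fun S _ => ?_
    by_cases hS : S ∈ F.powerset
    · rw [if_pos hS]
    · rw [if_neg hS, hG]
      simp only
      rw [if_neg]
      rwa [Finset.coe_subset, ← Finset.mem_powerset]
  have h3 : (∑ S : Finset (Sym2 V), if S ∈ F.powerset then G (↑S : BondConfig V) else 0) =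
      ∑ S ∈ F.powerset, G (↑S : BondConfig V) := by
    rw [← Finset.sum_filter]
    congr 1
    ext S
    simp
  rw [h1, h2, h3]
  refine Finset.sum_congr rfl fun S hS => ?_
  have hSF : S ⊆ F := Finset.mem_powerset.1 hS
  have hsub : (↑S : BondConfig V) ⊆ ↑F := Finset.coe_subset.2 hSF
  rw [hG]
  simp only
  rw [if_pos hsub, Set.empty_union, Set.empty_union, ← Finset.coe_sdiff, antipodalQ_eq_tApexTab]
  rfl

/-- **NEW KERNEL ROW (census g36): Conjecture T with the APEX AT A TERMINAL and the pair = {other terminal, inner vertex}.**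
For a two-terminal series–parallel network `E` between `x` and `y`, an inner vertex `s` and every `q > 0`:
`0 ≤ antipodalT q x y s E ∅` (apex `x`, pair `{y, s}`), i.e. `δ(x; y, s) ≥ 0` coefficientwise for the graph `E` itself —
complementing `antipodalT_nonneg_of_isTTSP` (apex arbitrary, pair = THE TWO TERMINALS, all minors).  Proof: `T(x; y, s) ≥ T_sym`
coefficientwise and THEOREM 𝒯₁ (`tsym_nonneg`). [cite: AyyerLinussonRavichandran2025, §7 eq. (13)–(15) (p. 22)] -/
theorem antipodalT_nonneg_apex_left {q : ℝ} (hq : 0 < q) (hE : IsTTSP E x y) (hs : ∃ e ∈ E, s ∈ e) (hsx : s ≠ x)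
    (hsy : s ≠ y) : 0 ≤ antipodalT q x y s (↑E : BondConfig V) ∅ := by
  rw [antipodalT_eq_tval]
  have hw : ∀ n, 0 ≤ (fun n => q ^ n) n := fun n => pow_nonneg hq.le n
  exact (tsym_nonneg hE hs hsx hsy hw).trans (tval_mono tsymTab_le_tApexTab hw)

/-- **Conjecture T with the apex at the OTHER terminal**: `0 ≤ antipodalT q y x s E ∅` (apex `y`, pair `{x, s}`), by the
symmetry of two-terminal networks (`IsTTSP.symm`). [cite: AyyerLinussonRavichandran2025, §7 eq. (13)–(15) (p. 22)] -/
theorem antipodalT_nonneg_apex_right {q : ℝ} (hq : 0 < q) (hE : IsTTSP E x y) (hs : ∃ e ∈ E, s ∈ e) (hsx : s ≠ x)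
    (hsy : s ≠ y) : 0 ≤ antipodalT q y x s (↑E : BondConfig V) ∅ :=
  antipodalT_nonneg_apex_left hq hE.symm hs hsy hsx

end ApexTerminal

end FK

end Summit.CriticalPhenomena.PercolationContinuityZ3.Theorems

end
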